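import Summits.HodgeConjecture.HodgeConjecture.Theses.AnchorTransport
import Summits.HodgeConjecture.HodgeConjecture.Theorems.AnchorTransportVariationalHodgeQuasiProjective
import Summits.HodgeConjecture.HodgeConjecture.Theorems.AnchorTransportVariationalHodgeCorrespondenceTransport
import Summits.HodgeConjecture.HodgeConjecture.Theorems.AnchorTransportVariationalHodgeLefschetzRange
import Summits.HodgeConjecture.HodgeConjecture.Theorems.AnchorTransportVariationalHodgeStubDominanceAlongSmooth
import Summits.HodgeConjecture.HodgeConjecture.Theorems.AnchorTransportVariationalHodgePencilSweep
import Summits.HodgeConjecture.HodgeConjecture.Theorems.AnchorTransportVariationalHodgeHDirection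
import Summits.HodgeConjecture.HodgeConjecture.Theorems.AnchorTransportVariationalHodgeStubCarriesClassOfCycleClass
import Summits.HodgeConjecture.HodgeConjecture.Theorems.AnchorTransportVariationalHodgeStubThomasDescentOfSweep
import Summits.HodgeConjecture.HodgeConjecture.Theorems.AnchorTransportVariationalHodgeCodimSplit
import Literature.AlgebraicGeometry.HodgeTheory.LefschetzOneOneHolds
import Literature.AlgebraicGeometry.HodgeTheory.HardLefschetzNFoldHolds
import Literature.AlgebraicGeometry.HodgeTheory.ClassesSupportedOn
import Literature.AlgebraicGeometry.HodgeTheory.BlochSemiregularityTheorem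
import Literature.AlgebraicGeometry.HodgeTheory.FlatFamilyCycleClass
import Literature.AlgebraicGeometry.HodgeTheory.AlgebraicityLocusLinearSections
import Literature.AlgebraicGeometry.HodgeTheory.AlgebraicClassesHodgeTypeHolds
import Literature.AlgebraicGeometry.Motives.CompleteIntersection
import Literature.AlgebraicGeometry.Deformation.SquareZeroExtensionObstruction
import HarnessLib

/-!
# Route AnchorTransport — `VariationalHodge` (stmt-HodgeConjecture-1076): the REACH of the line `polar-patch-broken-cycles`

The COMPOSITION of the line `polar-patch-broken-cycles` (crux workfile
`Cruxes/VariationalHodge/Lines/polar_patch_broken_cycles.lean`, generations 1–7, leads c1-0…c4-0), stated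
over tree declarations only and proved from the tree's landed stubs, so that it can be imported and cited:

* `polarPatch_vhcTwo_four` — **the fourfold case**: Grothendieck's variational Hodge statement in
  codimension `2` for smooth projective families of FOURFOLDS with quasi-projective total space over
  smooth irreducible affine bases follows from three inputs: Bloch's semiregularity theorem
  (`Bloch1972_semiregularSubschemeLifts`, Bloch 1972 Thm. (7.1) with the proof of (7.4): NAMED FACT),
  the specialisation of the cycle class of a flat family (`fulton1998_flatFamily_cycleClass_specialises`,
  Fulton 1998 Cor. 10.1 / Lemma 19.1.1: NAMED FACT), and the line's BET (registered stub
  `stub_semiregularBrokenRepresentative`, research-open: every non-ambient rational `(2,2)` algebraic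
  class on a smooth projective fourfold `X₀ ⊆ ℙᴺ` has, modulo ambient classes and up to a non-zero
  rational multiple, a Bloch-semiregular broken-cycle lci representative). Proof: an AMBIENT anchor
  class is rigid and algebraic by the moving lemma; otherwise the bet gives the semiregular broken cycle
  `Z₀` on the anchor fibre, each component class staying of type `(2,2)` along the family, Bloch's
  theorem lifts it to a flat family over a smooth base change, the landed CARRY
  (`stub_carriesClassOfCycleClass`, p139363) makes `A` algebraic on the fibres over a Zariski
  neighbourhood, and the landed DOMINANCE (`stub_dominanceAlongSmooth`, p135546) spreads this to every
  fibre.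
* `polarPatch_vhcTwo_all` — the same in EVERY relative dimension: `n ≤ 3` is the Lefschetz range
  (`variationalHodge_of_dim_le_three` with the discharged Lefschetz facts), `n = 4` is the fourfold case,
  `n ≥ 5` is Thomas's hyperplane descent (`stub_thomasDescentOfSweep`, p147233, fed with the landed
  pencil sweep p137114 and `H`-direction p139049).
* `variationalHodge_of_polarPatchInputs` — **the crux modulo the line's five registered stubs**: the three
  inputs above together with the strategist's two CODIM-SPLIT children (`p = 2` on non-quasi-projective
  total spaces; `3 ≤ p ≤ n - 2`), verbatim, imply `AnchorTransport.VariationalHodge`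
  (`variationalHodge_of_codimSplit`, p153169).

These theorems are CONDITIONAL (two named facts and the bet are hypotheses); they certify in the tree what
the skeleton's `VariationalHodge_of` certifies in the workfile: the crux is closed modulo
{Bloch 1972, Fulton's flat-family cycle class, the bet, the two promoted children}.
References: Bloch, Invent. Math. 17 (1972) Thm. (7.1), (7.4), Rem. (7.5); Fulton, Intersection Theory
(1998) §10.1, §19.1; Thomas, arXiv:math/0212216 §5; Charles–Schnell, Notes on absolute Hodge classes
(2014) Conj. 11.3.1, Cor. 11.3.6.
-/

noncomputable section

-- every declaration of this problem lives in `Summit.HodgeConjecture.HodgeConjecture.…` (summit = sub-problem)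
set_option linter.dupNamespace false

open CategoryTheory CategoryTheory.Limits AlgebraicGeometry TopologicalSpace
open Literature.AlgebraicGeometry.Motives Literature.AlgebraicGeometry.HodgeTheory
open Literature.AlgebraicGeometry.Deformation (conormalSheaf)
open Summit.HodgeConjecture.HodgeConjecture.Theses.AnchorTransport

namespace Summit.HodgeConjecture.HodgeConjecture.Theorems

-- the grading of `ℂ[x₀,…,x_N]` by degree (as in `Motives/CompleteIntersection`), for `ProjectiveSpectrum.zeroLocus`
attribute [local instance] MvPolynomial.gradedAlgebra

/-- **THE FOURFOLD CASE of the line `polar-patch-broken-cycles`**: granted Bloch's semiregularity theorem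
(`hS1a`), Fulton's flat-family cycle class (`hS2a`) and the line's bet (`hS1b`: semiregular broken-cycle
representatives of non-ambient rational `(2,2)` algebraic classes on smooth projective fourfolds), the
variational Hodge statement holds in codimension `2` for every smooth projective family of fourfolds with
quasi-projective total space over a smooth irreducible affine base. An AMBIENT anchor class
(`m • A|_{X_{s₀}} = e^*u`) vanishes against `e^*u` on every fibre by rigidity of flat sections and is
algebraic by the moving lemma; a NON-AMBIENT one has the bet's Bloch-semiregular broken cycle `Z₀` as
representative, whose component classes `μ • A + e^*u'` stay of type `(2,2)` along the family, so Bloch's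
theorem lifts `Z₀` to a flat family over a smooth base change `V ⟶ S`; the carry
(`stub_carriesClassOfCycleClass`) then makes `A` algebraic on the fibres over a Zariski neighbourhood of
`v₀`, and dominance (`stub_dominanceAlongSmooth`) on every fibre.
[cite: Bloch1972Semiregularity, Thm. (7.1), Thm. (7.4), Rem. (7.5)] [cite: Fulton1998, Cor. 10.1 and Lemma 19.1.1] -/
theorem polarPatch_vhcTwo_four : (∀ ⦃X₀ : SchemeOver ℂ⦄, IsSmoothProjective 4 X₀ → ∀ ⦃N : ℕ⦄ (φ : X₀ ⟶ projectiveSpace N ℂ), IsClosedImmersion φ.left → ∀ (a : complexBetti X₀ (2 * 2)), IsRationalClass a → IsOfHodgeType 4 X₀ (2 * 2) 2 2 a → a ∈ algebraicClasses X₀ 2 → (∀ (u : complexBetti (projectiveSpace N ℂ) (2 * 2)) (m : ℚ), m ≠ 0 → (m : ℂ) • a - complexBetti.map φ (2 * 2) u ≠ 0) → ∃ (W₀ : Scheme) (i₀ : W₀ ⟶ X₀.left) (_ : IsClosedImmersion i₀) (_ : IsIntegral W₀) (_ : IsFiniteLocallyFree (conormalSheaf i₀)) (_ : ∀ w : W₀,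 (2 : ℕ∞) ≤ Order.coheight (i₀.base w)) (_ : ∃ w : W₀, Order.coheight (i₀.base w) = 2) (m : ℚ) (_ : m ≠ 0) (u : complexBetti (projectiveSpace N ℂ) (2 * 2)) (_ : (m : ℂ) • a - complexBetti.map φ (2 * 2) u ∈ classesSupportedOn X₀ (Set.range i₀.base) (2 * 2)) (J k : ℕ) (d : Fin J → ℕ) (h : MvPolynomial (Fin (N + 1)) ℂ) (q : Fin J → MvPolynomial (Fin (N + 1)) ℂ) (_ : 0 < k) (_ : ∀ j, 0 < d j) (_ : h.IsHomogeneous k) (_ : ∀ j, (q j).IsHomogeneous (d j)) (_ : ∃ w : W₀, φ.left.base (i₀.base w) ∉ (ProjectiveSpectrum.zeroLocus (MvPolynomial.homogeneousSubmodule (Fin (N + 1)) ℂ) {h} : Set (projectiveSpace N ℂ).left)) (_ : ∀ (j : Fin J) (w : W₀), φ.left.base (i₀.base w) ∈ (ProjectiveSpectrum.zeroLocus (MvPolynomial.homogeneousSubmodule (Fin (N + 1)) ℂ) {h} : Set (projectiveSpace N ℂ).left) → φ.left.base (i₀.base w) ∈ (ProjectiveSpectrum.zeroLocus (MvPolynomial.homogeneousSubmodule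 (Fin (N + 1)) ℂ) {q j} : Set (projectiveSpace N ℂ).left)) (_ : ∀ j : Fin J, IsIrreducible (φ.left.base ⁻¹' ((ProjectiveSpectrum.zeroLocus (MvPolynomial.homogeneousSubmodule (Fin (N + 1)) ℂ) {h} : Set (projectiveSpace N ℂ).left) ∩ (ProjectiveSpectrum.zeroLocus (MvPolynomial.homogeneousSubmodule (Fin (N + 1)) ℂ) {q j} : Set (projectiveSpace N ℂ).left)))) (_ : ∀ (j : Fin J) (x : X₀.left), φ.left.base x ∈ (ProjectiveSpectrum.zeroLocus (MvPolynomial.homogeneousSubmodule (Fin (N + 1)) ℂ) {h} : Set (projectiveSpace N ℂ).left) ∩ (ProjectiveSpectrum.zeroLocus (MvPolynomial.homogeneousSubmodule (Fin (N + 1)) ℂ) {q j} : Set (projectiveSpace N ℂ).left) → (2 : ℕ∞) ≤ Order.coheight x) (_ : classesSupportedOn X₀ {x | φ.left.base x ∈ (ProjectiveSpectrum.zeroLocus (MvPolynomial.homogeneousSubmodule (Fin (N + 1)) ℂ) {h} : Set (projectiveSpace N ℂ).left) ∧ ∃ j : Fin J, φ.left.base x ∈ (ProjectiveSpectrum.zeroLocus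 (MvPolynomial.homogeneousSubmodule (Fin (N + 1)) ℂ) {q j} : Set (projectiveSpace N ℂ).left)} (2 * 2) ≤ LinearMap.range (complexBetti.map φ (2 * 2)).hom) (Z₀ : Scheme) (iZ : Z₀ ⟶ X₀.left) (_ : IsClosedImmersion iZ) (_ : IsFiniteLocallyFree (conormalSheaf iZ)) (_ : iZ.ker = i₀.ker ⊓ ⨅ j : Fin J, (pullback.snd (completeIntersectionι ![h, q j]).left φ.left).ker) (_ : Set.range iZ.base = Set.range i₀.base ∪ {x | φ.left.base x ∈ (ProjectiveSpectrum.zeroLocus (MvPolynomial.homogeneousSubmodule (Fin (N + 1)) ℂ) {h} : Set (projectiveSpace N ℂ).left) ∧ ∃ j : Fin J, φ.left.base x ∈ (ProjectiveSpectrum.zeroLocus (MvPolynomial.homogeneousSubmodule (Fin (N + 1)) ℂ) {q j} : Set (projectiveSpace N ℂ).left)}) (_ : ∀ z : Z₀, ∃ z' : Z₀, Order.coheight (iZ.base z') = (2 : ℕ∞) ∧ iZ.base z' ⤳ iZ.base z) (_ : IsBlochSemiregular iZ 4 2), ∀ z : Z₀, Order.coheight (iZ.base z) = (2 : ℕ∞)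 → ∃ (μ : ℂ) (u' : complexBetti (projectiveSpace N ℂ) (2 * 2)), μ • a + complexBetti.map φ (2 * 2) u' ∈ classesSupportedOn X₀ (closure {iZ.base z}) (2 * 2) ∧ μ • a + complexBetti.map φ (2 * 2) u' ≠ 0) → Bloch1972_semiregularSubschemeLifts → fulton1998_flatFamily_cycleClass_specialises → ∀ ⦃𝒳 S : SchemeOver ℂ⦄ (f : 𝒳 ⟶ S), IsSmoothProjectiveFamily f 4 → IsQuasiProjectiveOver 𝒳 → IrreducibleSpace S.left → IsAffine S.left → AlgebraicGeometry.Smooth S.hom → ∀ (A : complexBetti 𝒳 (2*2)), (∀ s, IsRationalClass (complexBetti.map (fiberι f s) (2*2) A) ∧ IsOfHodgeType 4 (fiberOver f s) (2*2) 2 2 (complexBetti.map (fiberι f s) (2*2) A)) → (∃ s₀, complexBetti.map (fiberι f s₀) (2*2) A ∈ algebraicClasses (fiberOver f s₀) 2) → ∀ s, complexBetti.map (fiberι f s) (2*2) A ∈ algebraicClasses (fiberOver f s) 2 := by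
  intro hS1b hS1a hS2a 𝒳 S f hf hqp hirr haff hsm A hA hs₀ s
  obtain ⟨s₀, hs₀⟩ := hs₀
  haveI := hirr
  haveI := haff
  haveI := hsm
  by_cases hamb : ∃ (N : ℕ) (e : 𝒳 ⟶ projectiveSpace N ℂ) (u : complexBetti (projectiveSpace N ℂ) (2 * 2))
      (m : ℚ), m ≠ 0 ∧ (m : ℂ) • complexBetti.map (fiberι f s₀) (2 * 2) A -
        complexBetti.map (fiberι f s₀ ≫ e) (2 * 2) u = 0
  · -- AMBIENT ANCHOR CLASS: `m • A - e^* u` vanishes on `X_{s₀}`, hence on every fibre (rigidity), and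
    -- `A|_{X_s} = m⁻¹ • (e^* u)|_{X_s}` is algebraic by the moving lemma; no lever needed.
    obtain ⟨N, e, u, m, hm, h0⟩ := hamb
    haveI : IsAffineHom S.hom := inferInstance
    haveI : IsSeparated S.hom := inferInstance
    haveI : CompactSpace S.left := isCompact_univ_iff.mp (isAffineOpen_top S.left).isCompact
    have hres : ∀ t : ComplexPoints S,
        complexBetti.map (fiberι f t) (2 * 2) ((m : ℂ) • A - complexBetti.map e (2 * 2) u) =
          (m : ℂ) • complexBetti.map (fiberι f t) (2 * 2) A - complexBetti.map (fiberι f t ≫ e) (2 * 2) u := by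
      intro t
      rw [map_sub, map_smul, complexBetti.map_comp (fiberι f t) e]
      rfl
    have hs : (m : ℂ) • complexBetti.map (fiberι f s) (2 * 2) A -
        complexBetti.map (fiberι f s ≫ e) (2 * 2) u = 0 := by
      rw [← hres s, complexBetti_map_fiberι_eq_of_eq f hf (2 * 2) ((m : ℂ) • A - complexBetti.map e (2 * 2) u)
        0 s₀ s (by rw [hres s₀, h0, map_zero]), map_zero]
    rw [sub_eq_zero] at hs
    have hmC : (m : ℂ) ≠ 0 := by exact_mod_cast hm
    have halg : (m : ℂ) • complexBetti.map (fiberι f s) (2 * 2) A ∈ algebraicClasses (fiberOver f s) 2 := by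
      rw [hs]
      exact map_projectiveSpace_mem_algebraicClasses (hf.isSmoothProjective s) (fiberι f s ≫ e) 2 u
    have h := Submodule.smul_mem (algebraicClasses (fiberOver f s) 2) (m : ℂ)⁻¹ halg
    rwa [smul_smul, inv_mul_cancel₀ hmC, one_smul] at h
  · push Not at hamb
    -- NON-AMBIENT ANCHOR CLASS. The embedding `e : 𝒳 ⟶ ℙᴺ` of the quasi-projective total space.
    have hqp' := hqp
    obtain ⟨P, jP, ⟨N, κ, hκ⟩, hjP⟩ := hqp
    haveI := hκ
    haveI := hjP
    haveI := hf.isProper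
    set e : 𝒳 ⟶ projectiveSpace N ℂ := jP ≫ κ with hedef
    haveI : IsPreimmersion e.left := by
      rw [hedef, Over.comp_left]
      infer_instance
    -- the anchor fibre and its closed embedding into `ℙᴺ`
    have hX₀ : IsSmoothProjective 4 (fiberOver f s₀) := hf.isSmoothProjective s₀
    have hφ : IsClosedImmersion (fiberι f s₀ ≫ e).left := isClosedImmersion_fiberι_comp_left f e s₀
    -- THE BET at `(X₀, φ, A|_{X₀})`: the semiregular broken cycle `Z₀ = W₀ ∪ ⋃ C_j`
    obtain ⟨W₀, i₀, hi₀, hint, _hlci, hcod, hcod2, m, hm, u, hclass, J, k, d, h, q, _hk, _hd, _hh, _hq, hnot,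
      _hinc, _hirrj, hcodj, hamb', Z₀, iZ, hiZ, hlciZ, _hker, hrange, hpure, hsr, hcomp⟩ :=
      hS1b hX₀ (fiberι f s₀ ≫ e) hφ _ (hA s₀).1 (hA s₀).2 hs₀ (fun u m hm => hamb N e u m hm)
    -- the Hartshorne-projective structure of `f`
    obtain ⟨N', ε', hε', hε'f⟩ := exists_isClosedImmersion_of_isSmoothProjectiveFamily hf hqp'
    -- the family-side Hodge input of Bloch's theorem: component classes stay of type `(2,2)`
    have hstay : ∀ z : Z₀, Order.coheight (iZ.base z) = (2 : ℕ∞) →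
        SupportClassStaysHodge f 4 2 s₀ (closure {iZ.base z}) := by
      intro z hz
      obtain ⟨μ, u', hsupp, hne⟩ := hcomp z hz
      have hres : ∀ s : ComplexPoints S,
          complexBetti.map (fiberι f s) (2 * 2) (μ • A + complexBetti.map e (2 * 2) u') =
            μ • complexBetti.map (fiberι f s) (2 * 2) A + complexBetti.map (fiberι f s ≫ e) (2 * 2) u' := by
        intro s
        rw [map_add, map_smul, complexBetti.map_comp (fiberι f s) e]
        rfl
      refine SupportClassStaysHodge.intro (μ • A + complexBetti.map e (2 * 2) u') (fun s => ?_) ?_ ?_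
      · rw [hres s]
        exact ((hA s).2.smul μ).add (hf.isSmoothProjective s)
          (isOfHodgeType_of_mem_algebraicClasses_of_isSmoothProjective (hf.isSmoothProjective s) 2
            (map_projectiveSpace_mem_algebraicClasses (hf.isSmoothProjective s) (fiberι f s ≫ e) 2 u'))
      · rw [hres s₀]; exact hsupp
      · rw [hres s₀]; exact hne
    -- BLOCH'S THEOREM (`hS1a`): the flat lift of `Z₀` over a smooth (étale) base change `π : V ⟶ S`
    obtain ⟨V, π, hπ, v₀, hv₀, 𝒲, ι, hι, hflat, εZ, hcompat⟩ :=
      hS1a.of_smooth f 4 2 hf ⟨N', ε', hε', hε'f⟩ hsm s₀ Z₀ iZ hiZ hlciZ hpure hstay hsr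
    subst hv₀
    -- THE CARRY (`stub_carriesClassOfCycleClass`, granted `hS2a`), with the patch set `P = φ⁻¹(V₊(h)) ∩ ⋃ j, φ⁻¹(V₊(q j))`
    set Pset : Set (fiberOver f (AlgPoints.map π v₀)).left :=
      {x | (fiberι f (AlgPoints.map π v₀) ≫ e).left.base x ∈
          (ProjectiveSpectrum.zeroLocus (MvPolynomial.homogeneousSubmodule (Fin (N + 1)) ℂ) {h} :
            Set (projectiveSpace N ℂ).left) ∧
        ∃ j : Fin J, (fiberι f (AlgPoints.map π v₀) ≫ e).left.base x ∈
          (ProjectiveSpectrum.zeroLocus (MvPolynomial.homogeneousSubmodule (Fin (N + 1)) ℂ) {q j} :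
            Set (projectiveSpace N ℂ).left)} with hP
    have hclosed : ∀ T : Set (MvPolynomial (Fin (N + 1)) ℂ),
        IsClosed (ProjectiveSpectrum.zeroLocus (MvPolynomial.homogeneousSubmodule (Fin (N + 1)) ℂ) T :
          Set (projectiveSpace N ℂ).left) := fun T =>
      ProjectiveSpectrum.isClosed_zeroLocus _ T
    have hPeq : Pset = (fiberι f (AlgPoints.map π v₀) ≫ e).left.base ⁻¹'
          (ProjectiveSpectrum.zeroLocus (MvPolynomial.homogeneousSubmodule (Fin (N + 1)) ℂ) {h} :
            Set (projectiveSpace N ℂ).left) ∩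
        ⋃ j : Fin J, (fiberι f (AlgPoints.map π v₀) ≫ e).left.base ⁻¹'
          (ProjectiveSpectrum.zeroLocus (MvPolynomial.homogeneousSubmodule (Fin (N + 1)) ℂ) {q j} :
            Set (projectiveSpace N ℂ).left) := by
      ext x
      simp only [hP, Set.mem_setOf_eq, Set.mem_inter_iff, Set.mem_preimage, Set.mem_iUnion]
      constructor <;> rintro ⟨h1, j, h2⟩ <;> exact ⟨h1, j, h2⟩
    have hPc : IsClosed Pset := by
      rw [hPeq]
      exact ((hclosed {h}).preimage (fiberι f (AlgPoints.map π v₀) ≫ e).left.continuous).inter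
        (isClosed_iUnion_of_finite fun j =>
          (hclosed {q j}).preimage (fiberι f (AlgPoints.map π v₀) ≫ e).left.continuous)
    have hcodP : ∀ x ∈ Pset, (2 : ℕ∞) ≤ Order.coheight x := fun x hx => by
      obtain ⟨hxh, j, hxj⟩ := hx
      exact hcodj j x ⟨hxh, hxj⟩
    have hnotP : ∃ w : W₀, i₀.base w ∉ Pset := by
      obtain ⟨w, hw⟩ := hnot
      exact ⟨w, fun hwP => hw hwP.1⟩
    obtain ⟨U, hUo, hv₀U, halg⟩ := stub_carriesClassOfCycleClass hS2a f hf hqp' hirr haff hsm A V π hπ v₀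
      N e W₀ i₀ hi₀ hint hcod hcod2 m hm u hclass Pset hPc hcodP hnotP hamb' Z₀ iZ hrange 𝒲 ι hι hflat
      εZ hcompat
    -- DOMINANCE along the smooth base change (`stub_dominanceAlongSmooth`)
    exact stub_dominanceAlongSmooth f hf hqp' hirr haff hsm 2 A V π hπ U hUo ⟨v₀.pt, hv₀U⟩ halg s

/-- **The line's reach in EVERY relative dimension** (granted the same three inputs): the variational Hodge
statement in codimension `2` for smooth projective families with quasi-projective total space over smooth
irreducible affine bases, any relative dimension `n`. For `n ≤ 3` the codimension `2` lies in the Lefschetz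
range (`variationalHodge_of_dim_le_three`, unconditional with `lefschetzOneOne_rational_holds`,
`nonempty_hardLefschetzNFold_holds`); `n = 4` is `polarPatch_vhcTwo_four`; `n ≥ 5` is Thomas's hyperplane
descent `stub_thomasDescentOfSweep` fed with the landed pencil sweep (`stub_pencilSweep`) and
`H`-direction (`stub_hDirection`). [cite: Thomas2005Nodes, §5]
[cite: Bloch1972Semiregularity, Thm. (7.4), Rem. (7.5)] [cite: Fulton1998, Cor. 10.1 and Lemma 19.1.1] -/
theorem polarPatch_vhcTwo_all : (∀ ⦃X₀ : SchemeOver ℂ⦄, IsSmoothProjective 4 X₀ → ∀ ⦃N : ℕ⦄ (φ : X₀ ⟶ projectiveSpace N ℂ), IsClosedImmersion φ.left → ∀ (a : complexBetti X₀ (2 * 2)), IsRationalClass a → IsOfHodgeType 4 X₀ (2 * 2) 2 2 a → a ∈ algebraicClasses X₀ 2 → (∀ (u : complexBetti (projectiveSpace N ℂ) (2 * 2)) (m : ℚ), m ≠ 0 → (m : ℂ) • a - complexBetti.map φ (2 * 2) u ≠ 0) → ∃ (W₀ : Scheme) (i₀ : W₀ ⟶ X₀.left) (_ : IsClosedImmersion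 i₀) (_ : IsIntegral W₀) (_ : IsFiniteLocallyFree (conormalSheaf i₀)) (_ : ∀ w : W₀, (2 : ℕ∞) ≤ Order.coheight (i₀.base w)) (_ : ∃ w : W₀, Order.coheight (i₀.base w) = 2) (m : ℚ) (_ : m ≠ 0) (u : complexBetti (projectiveSpace N ℂ) (2 * 2)) (_ : (m : ℂ) • a - complexBetti.map φ (2 * 2) u ∈ classesSupportedOn X₀ (Set.range i₀.base) (2 * 2)) (J k : ℕ) (d : Fin J → ℕ) (h : MvPolynomial (Fin (N + 1)) ℂ) (q : Fin J → MvPolynomial (Fin (N + 1)) ℂ) (_ : 0 < k) (_ : ∀ j, 0 < d j) (_ : h.IsHomogeneous k) (_ : ∀ j, (q j).IsHomogeneous (d j)) (_ : ∃ w : W₀, φ.left.base (i₀.base w) ∉ (ProjectiveSpectrum.zeroLocus (MvPolynomial.homogeneousSubmodule (Fin (N + 1)) ℂ) {h} : Set (projectiveSpace N ℂ).left)) (_ : ∀ (j : Fin J) (w : W₀), φ.left.base (i₀.base w) ∈ (ProjectiveSpectrum.zeroLocus (MvPolynomial.homogeneousSubmodule (Fin (N + 1)) ℂ) {h} : Set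 (projectiveSpace N ℂ).left) → φ.left.base (i₀.base w) ∈ (ProjectiveSpectrum.zeroLocus (MvPolynomial.homogeneousSubmodule (Fin (N + 1)) ℂ) {q j} : Set (projectiveSpace N ℂ).left)) (_ : ∀ j : Fin J, IsIrreducible (φ.left.base ⁻¹' ((ProjectiveSpectrum.zeroLocus (MvPolynomial.homogeneousSubmodule (Fin (N + 1)) ℂ) {h} : Set (projectiveSpace N ℂ).left) ∩ (ProjectiveSpectrum.zeroLocus (MvPolynomial.homogeneousSubmodule (Fin (N + 1)) ℂ) {q j} : Set (projectiveSpace N ℂ).left)))) (_ : ∀ (j : Fin J) (x : X₀.left), φ.left.base x ∈ (ProjectiveSpectrum.zeroLocus (MvPolynomial.homogeneousSubmodule (Fin (N + 1)) ℂ) {h} : Set (projectiveSpace N ℂ).left) ∩ (ProjectiveSpectrum.zeroLocus (MvPolynomial.homogeneousSubmodule (Fin (N + 1)) ℂ) {q j} : Set (projectiveSpace N ℂ).left) → (2 : ℕ∞) ≤ Order.coheight x) (_ : classesSupportedOn X₀ {x | φ.left.base x ∈ (ProjectiveSpectrum.zeroLocus (MvPolynomial.homogeneousSubmodule (Fin (N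 + 1)) ℂ) {h} : Set (projectiveSpace N ℂ).left) ∧ ∃ j : Fin J, φ.left.base x ∈ (ProjectiveSpectrum.zeroLocus (MvPolynomial.homogeneousSubmodule (Fin (N + 1)) ℂ) {q j} : Set (projectiveSpace N ℂ).left)} (2 * 2) ≤ LinearMap.range (complexBetti.map φ (2 * 2)).hom) (Z₀ : Scheme) (iZ : Z₀ ⟶ X₀.left) (_ : IsClosedImmersion iZ) (_ : IsFiniteLocallyFree (conormalSheaf iZ)) (_ : iZ.ker = i₀.ker ⊓ ⨅ j : Fin J, (pullback.snd (completeIntersectionι ![h, q j]).left φ.left).ker) (_ : Set.range iZ.base = Set.range i₀.base ∪ {x | φ.left.base x ∈ (ProjectiveSpectrum.zeroLocus (MvPolynomial.homogeneousSubmodule (Fin (N + 1)) ℂ) {h} : Set (projectiveSpace N ℂ).left) ∧ ∃ j : Fin J, φ.left.base x ∈ (ProjectiveSpectrum.zeroLocus (MvPolynomial.homogeneousSubmodule (Fin (N + 1)) ℂ) {q j} : Set (projectiveSpace N ℂ).left)}) (_ : ∀ z : Z₀, ∃ z' : Z₀, Order.coheight (iZ.base z') = (2 : ℕ∞) ∧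 iZ.base z' ⤳ iZ.base z) (_ : IsBlochSemiregular iZ 4 2), ∀ z : Z₀, Order.coheight (iZ.base z) = (2 : ℕ∞) → ∃ (μ : ℂ) (u' : complexBetti (projectiveSpace N ℂ) (2 * 2)), μ • a + complexBetti.map φ (2 * 2) u' ∈ classesSupportedOn X₀ (closure {iZ.base z}) (2 * 2) ∧ μ • a + complexBetti.map φ (2 * 2) u' ≠ 0) → Bloch1972_semiregularSubschemeLifts → fulton1998_flatFamily_cycleClass_specialises → ∀ (n : ℕ) ⦃𝒳 S : SchemeOver ℂ⦄ (f : 𝒳 ⟶ S), IsSmoothProjectiveFamily f n → IsQuasiProjectiveOver 𝒳 → IrreducibleSpace S.left → IsAffine S.left → AlgebraicGeometry.Smooth S.hom → ∀ (A : complexBetti 𝒳 (2*2)), (∀ s, IsRationalClass (complexBetti.map (fiberι f s) (2*2) A) ∧ IsOfHodgeType n (fiberOver f s) (2*2) 2 2 (complexBetti.map (fiberι f s) (2*2) A)) → (∃ s₀, complexBetti.map (fiberι f s₀) (2*2) A ∈ algebraicClasses (fiberOver f s₀) 2) → ∀ s, complexBetti.map (fiberι f s) (2*2) A ∈ algebraicClasses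 (fiberOver f s) 2 := by
  intro hS1b hS1a hS2a n
  rcases le_or_gt n 3 with hn | hn
  · exact fun _ _ f hf _ _ _ _ A hA _ s =>
      variationalHodge_of_dim_le_three lefschetzOneOne_rational_holds nonempty_hardLefschetzNFold_holds
        hn f hf 2 A hA s
  rcases Nat.lt_or_ge 4 n with hn5 | hn4
  · -- Thomas's descent from the fourfold case (the two frame hypotheses are the landed stubs)
    exact stub_thomasDescentOfSweep
      (fun hX ι _ _ ha hXt _ hT hTne hfib _ hpm hIH c halg => stub_pencilSweep hX ι ha hXt hT hTne hfib hpm hIH c halg)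
      (fun hX hV₂ ι _ a hXt V hsmV hfib c hc hpp _ ht₁ halg₁ t ht =>
        stub_hDirection hX hV₂ ι a hXt V hsmV hfib c hc hpp ht₁ halg₁ t ht)
      (polarPatch_vhcTwo_four hS1b hS1a hS2a) n hn5
  · obtain rfl : n = 4 := le_antisymm hn4 hn
    exact polarPatch_vhcTwo_four hS1b hS1a hS2a

/-- **`AnchorTransport.VariationalHodge` MODULO THE FIVE REGISTERED STUBS of the line
`polar-patch-broken-cycles`.** Granted Bloch's theorem (`hS1a`), Fulton's flat-family cycle class
(`hS2a`), the bet (`hS1b`) and the strategist's two CODIM-SPLIT children verbatim — the crux at `p = 2`,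
`n ≥ 4` on NON-quasi-projective total spaces over smooth irreducible affine curves (the filed decl's
modelling residue) and the crux at `3 ≤ p ≤ n - 2` over smooth irreducible affine curves (the open
remainder of Grothendieck's conjecture) — the crux holds as filed: `polarPatch_vhcTwo_all` is the first
child of the codimension split and `variationalHodge_of_codimSplit` glues. This is the skeleton theorem
`VariationalHodge_of` of the crux workfile, as a theorem of the tree.
[cite: CharlesSchnell2014Notes, Conj. 11.3.1 and Cor. 11.3.6] [cite: Bloch1972Semiregularity, Thm. (7.4), Rem. (7.5)] -/
theorem variationalHodge_of_polarPatchInputs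
    (hS1b : ∀ ⦃X₀ : SchemeOver ℂ⦄, IsSmoothProjective 4 X₀ →
      ∀ ⦃N : ℕ⦄ (φ : X₀ ⟶ projectiveSpace N ℂ), IsClosedImmersion φ.left →
      ∀ (a : complexBetti X₀ (2 * 2)), IsRationalClass a → IsOfHodgeType 4 X₀ (2 * 2) 2 2 a →
        a ∈ algebraicClasses X₀ 2 →
      (∀ (u : complexBetti (projectiveSpace N ℂ) (2 * 2)) (m : ℚ), m ≠ 0 →
        (m : ℂ) • a - complexBetti.map φ (2 * 2) u ≠ 0) →
      ∃ (W₀ : Scheme) (i₀ : W₀ ⟶ X₀.left) (_ : IsClosedImmersion i₀) (_ : IsIntegral W₀)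
        (_ : IsFiniteLocallyFree (conormalSheaf i₀))
        (_ : ∀ w : W₀, (2 : ℕ∞) ≤ Order.coheight (i₀.base w))
        (_ : ∃ w : W₀, Order.coheight (i₀.base w) = 2)
        (m : ℚ) (_ : m ≠ 0) (u : complexBetti (projectiveSpace N ℂ) (2 * 2))
        (_ : (m : ℂ) • a - complexBetti.map φ (2 * 2) u ∈ classesSupportedOn X₀ (Set.range i₀.base) (2 * 2))
        (J k : ℕ) (d : Fin J → ℕ) (h : MvPolynomial (Fin (N + 1)) ℂ) (q : Fin J → MvPolynomial (Fin (N + 1)) ℂ)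
        (_ : 0 < k) (_ : ∀ j, 0 < d j) (_ : h.IsHomogeneous k) (_ : ∀ j, (q j).IsHomogeneous (d j))
        (_ : ∃ w : W₀, φ.left.base (i₀.base w) ∉ (ProjectiveSpectrum.zeroLocus (MvPolynomial.homogeneousSubmodule (Fin (N + 1)) ℂ) {h} :
              Set (projectiveSpace N ℂ).left))
        (_ : ∀ (j : Fin J) (w : W₀), φ.left.base (i₀.base w) ∈ (ProjectiveSpectrum.zeroLocus (MvPolynomial.homogeneousSubmodule (Fin (N + 1)) ℂ) {h} :
              Set (projectiveSpace N ℂ).left) →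
              φ.left.base (i₀.base w) ∈ (ProjectiveSpectrum.zeroLocus (MvPolynomial.homogeneousSubmodule (Fin (N + 1)) ℂ) {q j} :
              Set (projectiveSpace N ℂ).left))
        (_ : ∀ j : Fin J, IsIrreducible (φ.left.base ⁻¹' ((ProjectiveSpectrum.zeroLocus (MvPolynomial.homogeneousSubmodule (Fin (N + 1)) ℂ) {h} :
              Set (projectiveSpace N ℂ).left) ∩
              (ProjectiveSpectrum.zeroLocus (MvPolynomial.homogeneousSubmodule (Fin (N + 1)) ℂ) {q j} :
              Set (projectiveSpace N ℂ).left))))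
        (_ : ∀ (j : Fin J) (x : X₀.left),
              φ.left.base x ∈ (ProjectiveSpectrum.zeroLocus (MvPolynomial.homogeneousSubmodule (Fin (N + 1)) ℂ) {h} :
              Set (projectiveSpace N ℂ).left) ∩
              (ProjectiveSpectrum.zeroLocus (MvPolynomial.homogeneousSubmodule (Fin (N + 1)) ℂ) {q j} :
              Set (projectiveSpace N ℂ).left) → (2 : ℕ∞) ≤ Order.coheight x)
        (_ : classesSupportedOn X₀
              {x | φ.left.base x ∈ (ProjectiveSpectrum.zeroLocus (MvPolynomial.homogeneousSubmodule (Fin (N + 1)) ℂ) {h} :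
              Set (projectiveSpace N ℂ).left) ∧ ∃ j : Fin J, φ.left.base x ∈ (ProjectiveSpectrum.zeroLocus (MvPolynomial.homogeneousSubmodule (Fin (N + 1)) ℂ) {q j} :
              Set (projectiveSpace N ℂ).left)} (2 * 2) ≤
            LinearMap.range (complexBetti.map φ (2 * 2)).hom)
        (Z₀ : Scheme) (iZ : Z₀ ⟶ X₀.left) (_ : IsClosedImmersion iZ)
        (_ : IsFiniteLocallyFree (conormalSheaf iZ))
        (_ : iZ.ker = i₀.ker ⊓ ⨅ j : Fin J, (pullback.snd (completeIntersectionι ![h, q j]).left φ.left).ker)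
        (_ : Set.range iZ.base = Set.range i₀.base ∪
              {x | φ.left.base x ∈ (ProjectiveSpectrum.zeroLocus (MvPolynomial.homogeneousSubmodule (Fin (N + 1)) ℂ) {h} :
              Set (projectiveSpace N ℂ).left) ∧ ∃ j : Fin J, φ.left.base x ∈ (ProjectiveSpectrum.zeroLocus (MvPolynomial.homogeneousSubmodule (Fin (N + 1)) ℂ) {q j} :
              Set (projectiveSpace N ℂ).left)})
        (_ : ∀ z : Z₀, ∃ z' : Z₀, Order.coheight (iZ.base z') = (2 : ℕ∞) ∧ iZ.base z' ⤳ iZ.base z)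
        (_ : IsBlochSemiregular iZ 4 2),
        ∀ z : Z₀, Order.coheight (iZ.base z) = (2 : ℕ∞) →
          ∃ (μ : ℂ) (u' : complexBetti (projectiveSpace N ℂ) (2 * 2)),
            μ • a + complexBetti.map φ (2 * 2) u' ∈ classesSupportedOn X₀ (closure {iZ.base z}) (2 * 2) ∧
            μ • a + complexBetti.map φ (2 * 2) u' ≠ 0)
    (hS1a : Bloch1972_semiregularSubschemeLifts) (hS2a : fulton1998_flatFamily_cycleClass_specialises) :
    (∀ ⦃n : ℕ⦄ ⦃𝒳 S : SchemeOver ℂ⦄ (f : 𝒳 ⟶ S), IsSmoothProjectiveFamily f n → ¬ (∃ (P : SchemeOver ℂ) (j : 𝒳 ⟶ P), IsProjectiveOver P ∧ IsOpenImmersion j.left) → IrreducibleSpace S.left → IsAffine S.left → AlgebraicGeometry.Smooth S.hom → topologicalKrullDim S.left = 1 → 4 ≤ n → ∀ (A : complexBetti 𝒳 (2 * 2)), (∀ s : ComplexPoints S, IsRationalClass (complexBetti.map (fiberι f s) (2 * 2) A) ∧ IsOfHodgeType n (fiberOver f s) (2 * 2) 2 2 (complexBetti.map (fiberι f s) (2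 * 2) A)) → (∃ s₀ : ComplexPoints S, complexBetti.map (fiberι f s₀) (2 * 2) A ∈ algebraicClasses (fiberOver f s₀) 2) → ∀ s : ComplexPoints S, complexBetti.map (fiberι f s) (2 * 2) A ∈ algebraicClasses (fiberOver f s) 2) →
    (∀ ⦃n : ℕ⦄ ⦃𝒳 S : SchemeOver ℂ⦄ (f : 𝒳 ⟶ S), IsSmoothProjectiveFamily f n → IrreducibleSpace S.left → IsAffine S.left → AlgebraicGeometry.Smooth S.hom → topologicalKrullDim S.left = 1 → ∀ (p : ℕ), 3 ≤ p → p + 2 ≤ n → ∀ (A : complexBetti 𝒳 (2 * p)), (∀ s : ComplexPoints S, IsRationalClass (complexBetti.map (fiberι f s) (2 * p) A) ∧ IsOfHodgeType n (fiberOver f s) (2 * p) p p (complexBetti.map (fiberι f s) (2 * p) A)) → (∃ s₀ : ComplexPoints S, complexBetti.map (fiberι f s₀) (2 * p) A ∈ algebraicClasses (fiberOver f s₀) p) → ∀ s : ComplexPoints S, complexBetti.map (fiberι f s) (2 * p) A ∈ algebraicClasses (fiberOver f s) p) →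
    VariationalHodge := fun hC2 hC3 =>
  variationalHodge_of_codimSplit
    (fun n _ _ f hf hqp hirr haff hsm A hA hs₀ s =>
      polarPatch_vhcTwo_all hS1b hS1a hS2a n f hf hqp hirr haff hsm A hA hs₀ s)
    hC2 hC3

end Summit.HodgeConjecture.HodgeConjecture.Theorems

end
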